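import Summits.BirchSwinnertonDyer.BirchSwinnertonDyer.Theorems.PrintCf2RamifiedOffTYZLayerOneSilencePeriod
import HarnessLib

/-!
# Crux `PrintCf2.RamifiedOffTYZOfFacts` (stmt-BirchSwinnertonDyer-20509), line `offtyz-v7`, LEAD cycle 11 (cruxlead-20509 g10), part 4d:
# LAYER-1 SILENCE READ IN THE RING CLASS TOWER — on the type R1 jump-one sector NO square lifts to `σ_{lm}` modulo `Gal(ℍ′/H′_{lm})`

THEOREMS ONLY (no `def`, no named fact, no `sorry`), `--supports stmt-BirchSwinnertonDyer-20509`.  The class-field-theoretic reading of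
`LayerOneSilencePeriod.galPt_sq_genusPeriod_eq_two_primes` (p723163) through g7's unified block law
`MoverAssembly.galPt_mul_self_Z_eq_add_ite` (`g²·Z(d) = Z(d) + [g(√−d) = √−d ∧ (g²)^{g(d)}σ_d⁻¹ ∈ Γ′_d]·τ(1)` on a block `d ≡ 5 (mod 8)`, THEOREM B
layer 1): on the sector `n = lm`, `l ≡ 1`, `m ≡ 5 (mod 8)` (type R1, `n ≡ 5`), with `s(n) ≥ 2`, **for every `g ∈ Gal(ℍ′_n/ℚ)` fixing `√−n`,
`(g²)^{g(n)}·σ_n⁻¹ ∉ Γ′_n = Gal(ℍ′_n/H′_n)`** (`not_mem_of_sq_pow_gK_two_primes`) — in the ring class tower `Cl′_n = Gal(H′_n/K_n) ↠ Cl_n`: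
the order-two generator `σ` of `Gal(H′_n/H_n)` is NOT of the form `h^{2g(n)}`, `h ∈ Cl′_n`.  On the `s = 1` members of the same residue type (`(m/l) = −1`)
the LEAD g7 produced such an `h` (the mover), so — granted the displays — the Legendre bit `(m/l)` is read by the `2g(n)`-th powers in the
conductor-`2` ring class group of `ℚ(√−lm)`: a Rédei-type statement that a refuter / kit seat can test independently of the genus-point theory
(consistency check of the typed TYZ §3 displays).  Same hypotheses as p723163.  Nothing is asserted; BSD is not proved by any of this.

References: [cite: TianYuanZhang2017, Prop. 3.2 (1), Thm. 3.6 (1) (p0012 L27–L29), proof of Lemma 3.21 (p0020 L55–L62), §3.1, Thm. 3.5, Lemma 3.18, Thm. 1.1];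
[cite: HeathBrown1994SelmerCongruentII, Appendix (Monsky), typescript p. 39 L10–L41]; [cite: Cox2013, §7.D Thm. 7.24, §9.A]; tree: p723163, g7 `…MoverSquares`.
-/

noncomputable section

open scoped Classical NumberField

open WeierstrassCurve WeierstrassCurve.Affine Finset Matrix Literature.NumberTheory.EllipticCurves
  Literature.NumberTheory.EllipticCurves.TianYuanZhang2017
  Literature.NumberTheory.EllipticCurves.TianYuanZhang2017.W2
  Literature.NumberTheory.EllipticCurves.HeathBrown1994
  Literature.NumberTheory.QuadraticFields.RingClass
  Literature.NumberTheory.QuadraticFields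
  Summit.BirchSwinnertonDyer.Rank1Residual.P2
  Summit.BirchSwinnertonDyer.PrintCf2.QForm
  Summit.BirchSwinnertonDyer.PrintCf2.MoverAssembly
  Summit.BirchSwinnertonDyer.PrintCf2.LevelTwoTwoPrimes
  Summit.BirchSwinnertonDyer.PrintCf2.LayerOneSilenceOdd
  Summit.BirchSwinnertonDyer.PrintCf2.LayerOneSilencePeriod

set_option autoImplicit false

namespace Summit.BirchSwinnertonDyer.PrintCf2.LayerOneSilenceRingClass

variable {n : ℕ} (D : GenusPointData n)

/-- From the unified block law: if `g²` fixes `Z(d)` (block `d ≡ 5 (mod 8)`) and `g` fixes `√−d`, then `(g²)^{g(d)}·σ_d⁻¹ ∉ Γ′_d`.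
[cite: TianYuanZhang2017, Prop. 3.2 (1), Thm. 3.6 (1), proof of Lemma 3.21 (p0020 L55–L62)] -/
theorem not_mem_of_galPt_sq_Z_eq {d : ℕ} (hd : d ∈ n.divisors) (hd8 : d % 8 = 5)
    {z : APoint D.H} {Φ : Finset (D.H ≃ₐ[ℚ] D.H)} {ΓH ΓH' : Subgroup (D.H ≃ₐ[ℚ] D.H)} {σ c : D.H ≃ₐ[ℚ] D.H}
    (h : D.CMBlockSpec d z Φ ΓH ΓH' σ c) (hc : D.ConjSpec c) (g : D.H ≃ₐ[ℚ] D.H) (hg : g (D.sqrtNeg d) = D.sqrtNeg d)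
    (hZ : D.galPt (g * g) (D.Z d) = D.Z d) : (g * g) ^ gK d * σ⁻¹ ∉ ΓH' := by
  intro hmem
  have e := galPt_mul_self_Z_eq_add_ite D hd hd8 h hc g
  rw [hZ, if_pos ⟨hg, hmem⟩, one_smul] at e
  have : (tauOne : APoint D.H) = 0 := by
    have := congrArg (fun x => x - D.Z d) e
    simpa using this.symm
  exact tauOne_ne_zero this

/-- **Type R1 (`n = lm`, `l ≡ 1`, `m ≡ 5 (mod 8)`, `s(n) ≥ 2`): no `g ∈ Gal(ℍ′_n/K_n)` has `(g²)^{g(n)} ≡ σ_n` modulo `Γ′_n = Gal(ℍ′_n/H′_n)`** — the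
Layer-1 silence of the genus period read in the conductor-`2` ring class tower of `K_n = ℚ(√−lm)` (hypotheses as in
`LayerOneSilencePeriod.galPt_sq_genusPeriod_eq_two_primes`).
[cite: TianYuanZhang2017, Prop. 3.2 (1), Thm. 3.6 (1), proof of Lemma 3.21, §3.1, Thm. 3.5, Lemma 3.18, Thm. 1.1] [cite: HeathBrown1994SelmerCongruentII, Appendix (Monsky), typescript p. 39 L10–L41] -/
theorem not_mem_of_sq_pow_gK_two_primes {l m : ℕ} (hl : l.Prime) (hm : m.Prime) (hl8 : l % 8 = 1) (hm5 : m % 8 = 5)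
    (hn : n = l * m) (hrec : D.recursion) (heps : D.epsSpec) (hLs : D.scriptLSpec) (h318 : D.lemma318)
    (z : ℕ → APoint D.H) (Φ : ℕ → Finset (D.H ≃ₐ[ℚ] D.H)) (ΓH ΓH' : ℕ → Subgroup (D.H ≃ₐ[ℚ] D.H))
    (σ : ℕ → (D.H ≃ₐ[ℚ] D.H)) (c : D.H ≃ₐ[ℚ] D.H) (ρ : (d : ℕ) → (D.galK d →* RingClassGroup (GenusField d) 2))
    (hc : D.ConjSpec c)
    (hblock : ∀ d ∈ n.divisors, ((d % 8 = 5 ∨ d % 8 = 6) → D.CMBlockSpec d (z d) (Φ d) (ΓH d) (ΓH' d) (σ d) c) ∧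
      (d % 8 = 7 → D.SevenBlockSpec d))
    (hring : ∀ d ∈ n.divisors, d % 8 = 5 → D.RingClassTwoBlockSpec d (ΓH d) (ΓH' d) (ρ d))
    (hFrob : ∀ d ∈ n.divisors, d % 8 = 5 → ∀ q : ℕ, q.Prime → q ∣ d → ∃ φ : D.H ≃ₐ[ℚ] D.H,
      φ (D.sqrtNeg d) = D.sqrtNeg d ∧ φ * φ ∈ ΓH' d ∧ φ D.im = (jacobiSym (-1) q) • D.im ∧
        ∀ r : ℕ, r.Prime → r ∣ n → r ≠ q → φ (D.sqrtNeg r) = (jacobiSym (-(r : ℤ)) q) • D.sqrtNeg r)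
    (h11 : thm11_parity_of_scriptL) {s : ℕ} (hs : 2 ≤ s)
    (hsel : Nat.card ((congruentNumberCurve n).selmerGroup 2) = 2 ^ (2 + s))
    {c' u : ℤ} (hLl : D.scriptL l = 2 * c') (hmdiv : m ∈ n.divisors) {α : APoint (GenusField m)}
    (h35m : IsOfFinAddOrder ((2 : ℤ) • D.P m - (u * D.scriptL m) • Point.map (W' := curveA) (D.embK m hmdiv) α))
    (g : D.H ≃ₐ[ℚ] D.H) (hg : g (D.sqrtNeg n) = D.sqrtNeg n) :
    (g * g) ^ gK n * (σ n)⁻¹ ∉ ΓH' n := by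
  have hn0 : n ≠ 0 := by rw [hn]; exact Nat.mul_ne_zero hl.ne_zero hm.ne_zero
  have hnn : n ∈ n.divisors := Nat.mem_divisors_self n hn0
  have hn5 : n % 8 = 5 := by rw [hn, mul_mod_eight_of_one hl8, hm5]
  have hZ := LayerOneSilencePeriod.galPt_sq_genusPeriod_eq_two_primes D hl hm hl8 (Or.inl hm5) hn hrec heps hLs h318 z Φ ΓH ΓH' σ c ρ hc
    hblock hring hFrob h11 hs hsel hLl hmdiv h35m g
  exact not_mem_of_galPt_sq_Z_eq D hnn hn5 ((hblock n hnn).1 (Or.inl hn5)) hc g hg hZ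

/-! ## §2 (append, LEAD g10) The block form of the silence for every odd `n ≡ 5, 7 (mod 8)` with `s(n) ≥ 2` -/

/-- **Silence in block form**: for odd `n = p₁⋯p_k ≡ 5, 7 (mod 8)` with `#Sel₂(E_n) = 2^{2+s}`, `s ≥ 2`, and every `g ∈ Gal(ℍ′_n/ℚ)`, the
weighted count of blocks `d ≡ 5 (mod 8)` (the top block `n` with weight `1`, each `d ∈ recursionIndex n` with weight `|𝓛(n/d)|`) such that
`g` fixes `√−d` and `(g²)^{g(d)}·σ_d⁻¹ ∈ Γ′_d` is EVEN (g7's `galPt_mul_self_P_ne_iff` + `LayerOneSilenceOdd`).  On type R1 the sum has the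
single term `d = n` up to the even weight `𝓛(l)`, recovering `not_mem_of_sq_pow_gK_two_primes`.
[cite: TianYuanZhang2017, §3.1 (p0011 L53–L73), Prop. 3.2 (1), Thm. 3.6 (1), (3), proof of Lemma 3.21 (p0020 L27–L63), Thm. 1.1]
[cite: HeathBrown1994SelmerCongruentII, Appendix (Monsky), typescript p. 39 L10–L41] -/
theorem not_odd_blockBits_of_card_selmer_odd {k : ℕ} (p : Fin k → ℕ) (hp : ∀ i, (p i).Prime) (hodd : ∀ i, Odd (p i))
    (hinj : Function.Injective p) (hn : n = ∏ i, p i) (h57 : n % 8 = 5 ∨ n % 8 = 7) (hrec : D.recursion) (hLs : D.scriptLSpec)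
    (z : ℕ → APoint D.H) (Φ : ℕ → Finset (D.H ≃ₐ[ℚ] D.H)) (ΓH ΓH' : ℕ → Subgroup (D.H ≃ₐ[ℚ] D.H))
    (σ : ℕ → (D.H ≃ₐ[ℚ] D.H)) (c : D.H ≃ₐ[ℚ] D.H) (ρ : (d : ℕ) → (D.galK d →* RingClassGroup (GenusField d) 2))
    (hc : D.ConjSpec c)
    (hblock : ∀ d ∈ n.divisors, ((d % 8 = 5 ∨ d % 8 = 6) → D.CMBlockSpec d (z d) (Φ d) (ΓH d) (ΓH' d) (σ d) c) ∧
      (d % 8 = 7 → D.SevenBlockSpec d))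
    (hring : ∀ d ∈ n.divisors, d % 8 = 5 → D.RingClassTwoBlockSpec d (ΓH d) (ΓH' d) (ρ d))
    (hFrob : ∀ d ∈ n.divisors, d % 8 = 5 → ∀ q : ℕ, q.Prime → q ∣ d → ∃ φ : D.H ≃ₐ[ℚ] D.H,
      φ (D.sqrtNeg d) = D.sqrtNeg d ∧ φ * φ ∈ ΓH' d ∧ φ D.im = (jacobiSym (-1) q) • D.im ∧
        ∀ r : ℕ, r.Prime → r ∣ n → r ≠ q → φ (D.sqrtNeg r) = (jacobiSym (-(r : ℤ)) q) • D.sqrtNeg r)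
    (h11 : thm11_parity_of_scriptL) {s : ℕ} (hs : 2 ≤ s)
    (hsel : Nat.card ((congruentNumberCurve n).selmerGroup 2) = 2 ^ (2 + s)) (g : D.H ≃ₐ[ℚ] D.H) :
    ¬ Odd ((if n % 8 = 5 ∧ g (D.sqrtNeg n) = D.sqrtNeg n ∧ (g * g) ^ gK n * (σ n)⁻¹ ∈ ΓH' n then 1 else 0) +
        ∑ d ∈ recursionIndex n, (D.scriptL (n / d)).natAbs *
          (if d % 8 = 5 ∧ g (D.sqrtNeg d) = D.sqrtNeg d ∧ (g * g) ^ gK d * (σ d)⁻¹ ∈ ΓH' d then 1 else 0)) := by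
  have hsq : Squarefree n := by rw [hn]; exact squarefree_prod_of_injective p hp hinj
  intro hOdd
  have hmove := (galPt_mul_self_P_ne_iff D hsq h57 hrec z Φ ΓH ΓH' σ c hc hblock g).mpr hOdd
  exact hmove (LayerOneSilenceOdd.galPt_sq_genusPoint_eq_of_card_selmer_odd p hp hodd hinj D hn h57 hrec hLs z Φ ΓH ΓH' σ c ρ hc
    hblock hring hFrob h11 hs hsel g)

end Summit.BirchSwinnertonDyer.PrintCf2.LayerOneSilenceRingClass

end
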